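import Summits.Ventures.GridStability.Models.WSCC9SP
import Summits.Ventures.GridStability.Models.StructurePreservingLurieRoa
import Summits.Ventures.GridStability.Models.StructurePreservingGlobal
import Summits.Ventures.GridStability.Models.StructurePreservingLurieLevel

/-!
# GridStability/Models/WSCC9SPLurie — the WSCC9-SP9 canary as a Vu–Turitsyn bilinear system relative
# to bus 9: every certificate-independent hypothesis of the SP / Lur'e lane discharged, and the lane's
# sentence with the ε-level (instance typing; NO certificate here)

LADDER-GRIDFUSION G2 «SP–Lur'e lane» CANARY (lead ruling R-SP9 2026-08-27T04:41:51Z: census / canary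
object, NOT OF RECORD; «it becomes a row candidate only if a producer delivers the QuadraticCertificate
(P, g, ε) with the TWO PSD facts and lyap-1 files lurie_roa_of_eps»), seat gridfusion-model-2 (g6).
Pattern of `NE39SPLurie.lean` (p494720 + p497124). MODEL-VALIDITY row MV-3, instance tokens of
`WSCC9SP` with «D⟨declared by the certificate⟩» in place of «D(∀)» and «ref bus 9 (bookkeeping;
conclusions reference-free)».

WHAT IS HERE (all PROVED, 0 kit, data = the tree's `WSCC9SP` literals, sp9.json 61008636cbb630ff network postB
column V1):
* `ref = 5` (bus 9, a first-order network bus), `gnode j = 6 + j`, `ref_gnode` (`ref ∉ gen`, injective) (machines G1, G2, G3 ↦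
  internal nodes 6, 7, 8);
* `WSCC9SP.relLurie D` — THE OBJECT a producer certifies: a
  `LyapunovFunctionFamily.System (Fin 8 ⊕ Fin 3) (Fin 8)` (11 states, 8 lines) whose `A, B, C` are
  rational in `(D, M = 2H/377, wt = 1/x)` and whose `δ*_e` are differences of `2·arctan` of the typed
  half-angle tangents [cite: VuTuritsyn2017, §3 eq. (Bilinear)];
* `relLurie_obs D` — observability for every `D`; `lineAngle_abs_le_theta`, `lineAngle_abs_lt`;
* `sectorGain_theta_gt` — certified rational gain bound `11/20 < g⋆(θ)`; `gain_lt`;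
* `levelRadius = 1.570796 − 2τ_max`, `levelRadius_lt`, `level_of_rational`, `epsLevel_lt`, `epsLevel_rational`;
* `lurie_roa`, `lurie_roa_of_rationalLevel`, `lurie_roa_of_isSolution` (rank-one route) and
  `lurie_roa_of_eps`, `lurie_roa_of_eps_of_isSolution` (ε-route: the producer supplies ONLY
  `Λ = (P, g ≤ 11/20, ε)` with its two 11 × 11 PosSemidef facts and a rational `c` with `2c ≤ ε·ρ²`).
WHAT IS NOT HERE: any `(P, g, ε, c)`; a DECLARED numeric `D` (producer tables
`models/WSCC9SP-relLurie.json`); nothing here says the WSCC system is stable. THREE COLUMNS: CERTIFIED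
(given `Λ`) = the `lurie_roa*` statements about MODEL M′ = `(WSCC9SP.params D).phaseField`; MODELLED =
the tokens of `WSCC9SP` + D⟨declared⟩ + ref bus 9; VALIDATED = any comparison with printed 9-bus numbers
(different model class: MV-2 Kron) or with [cite: VuTuritsyn2017, §5].
-/

noncomputable section

open Finset Real Set Filter Matrix
open scoped Topology
open Literature.MathematicalPhysics.PowerSystems
open Literature.MathematicalPhysics.PowerSystems.LyapunovFunctionFamily

namespace Summit.Ventures.GridStability.Models.WSCC9SP

open StructurePreserving StructurePreserving.Params

/-! ## Reference bus and generator enumeration -/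

/-- The reference bus: bus 9 (node index `5`), a first-order network bus. -/
def ref : Fin 9 := 5

/-- Enumeration of the generator internal nodes: machine `Gⱼ₊₁ ↦ node 6 + j`. -/
def gnode (j : Fin 3) : Fin 9 := ⟨6 + j.val, by omega⟩

/-- Bus 9 is not a generator internal node, and the enumeration `gnode` is injective (one
conjunction; halves `ref_gnode.1` / `.2`). -/
theorem ref_gnode : ref ∉ genS ∧ Function.Injective gnode := by
  refine ⟨by decide, fun a b h => ?_⟩
  have : (6 + a.val) = 6 + b.val := congrArg Fin.val h
  exact Fin.ext (by omega)

/-- The enumeration is onto `gen = {6, 7, 8}`. -/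
theorem mem_genS_iff : ∀ v : Fin 9, v ∈ genS ↔ ∃ j, gnode j = v := by decide

/-- `params D` has the edge-list couplings of the typed lists (definitional). -/
theorem params_b_eq (D : Fin 9 → ℝ) : (params D).b = symmetrize (edgeWeight srcV tgtV wt) := rfl

/-- `P⁰ = f(δ₀)` nodewise (eq=b). -/
theorem pe_δ₀_eq_P0 (D : Fin 9 → ℝ) : ∀ v, (params D).pe δ₀ v = (params D).P0 v :=
  fun v => (congrFun (params_P0 D) v).symm

/-- lyap-1's phase field of `params D` IS model-2's `(params D).phaseField` (`ω₀ = 0`). -/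
theorem lyapunov_phaseField_params (D : Fin 9 → ℝ) :
    Lyapunov.StructurePreserving.phaseField (params D) = (params D).phaseField := by
  rw [lyapunov_phaseField_eq, (params D).shifted_eq_self_of_P0_eq_pe b_symm (params_P0 D)]

/-! ## The bilinear object of the canary -/

/-- **THE SP–Lur'e OBJECT of «WSCC9-SP9»** for a damping / load-frequency vector `D`: the
structure-preserving model `params D` relative to bus 9, as lit-6's Vu–Turitsyn system on
`Fin 8 ⊕ Fin 3` states and `Fin 8` lines. MODELLED: MV-3 instance tokens + «D⟨declared⟩» + «ref bus 9».
[cite: VuTuritsyn2017, §3 eq. (Bilinear)] -/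
def relLurie (D : Fin 9 → ℝ) : LyapunovFunctionFamily.System (Fin 8 ⊕ Fin 3) (Fin 8) :=
  (params D).relLurie ref gnode srcV tgtV wt δ₀

/-- Unfolding lemma. -/
theorem relLurie_eq (D : Fin 9 → ℝ) :
    relLurie D = (params D).relLurie ref gnode srcV tgtV wt δ₀ := rfl

/-- **Observability** of the bilinear object, for every `D`: `Cx = 0 ∧ CAx = 0 ⇒ x = 0`
(connectivity of the 9-node coupling graph through bus 9). [cite: VuTuritsyn2017, Appendix 7.2] -/
theorem relLurie_obs (D : Fin 9 → ℝ) (x : Fin 8 ⊕ Fin 3 → ℝ) (h1 : (relLurie D).C *ᵥ x = 0)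
    (h2 : (relLurie D).C *ᵥ ((relLurie D).A *ᵥ x) = 0) : x = 0 :=
  Params.relLurie_obs ref_gnode.1 ref_gnode.2 mem_genS_iff (params_b_eq D) (preconnected D) x h1 h2

/-! ## Equilibrium line angles and the gain -/

/-- Every listed edge is a coupled pair of `params D`. -/
theorem b_edge_ne_zero (D : Fin 9 → ℝ) (e : Fin 8) : (params D).b (srcV e) (tgtV e) ≠ 0 := by
  rw [params_b_eq]
  exact symmetrize_edgeWeight_ne_zero_of_edge wt_nonneg e (wt_pos e) (Or.inl ⟨rfl, rfl⟩)

/-- **Equilibrium line angles are inside the window**: `|δ₀(src e) − δ₀(tgt e)| ≤ θ = 2·arctan τ_max`. -/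
theorem lineAngle_abs_le_theta (e : Fin 8) : |δ₀ (srcV e) - δ₀ (tgtV e)| ≤ θ :=
  window (fun _ => 1) (srcV e) (tgtV e) (b_edge_ne_zero _ e)

/-- `|δ*_e| < π/2` for every listed edge (hypothesis `hδs` of the lane's theorem). -/
theorem lineAngle_abs_lt (e : Fin 8) : |δ₀ (srcV e) - δ₀ (tgtV e)| < π / 2 :=
  (lineAngle_abs_le_theta e).trans_lt theta_bounds.2

/-- **A certified rational strict-gain bound**: `11/20 < g⋆(θ) = (1 − sin θ)/(π/2 − θ)`
(`sin θ = 2τ/(1 + τ²)` exactly; `θ = 2·arctan τ ≥ 2τ/√(1 + τ²) > 0.3000`; `π/2 < 1.5707965`).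
[cite: VuTuritsyn2017, §4.1 eq. (gain)] -/
theorem sectorGain_theta_gt : (11/20 : ℝ) < sectorGain θ := by
  have hτ0 : (0 : ℝ) < (tauV1 : ℝ) := by exact_mod_cast (show (0 : ℚ) < tauV1 by norm_num [tauV1])
  have hθ0 := theta_bounds.1
  have hθ := theta_bounds.2
  have hsin : Real.sin θ = 2 * (tauV1 : ℝ) / (1 + (tauV1 : ℝ) ^ 2) :=
    Lyapunov.StructurePreserving.sin_two_mul_arctan _
  have hq : (3/20 : ℝ) < Real.arctan (tauV1 : ℝ) := by
    have hat0 : 0 ≤ Real.arctan (tauV1 : ℝ) := by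
      have := Real.arctan_strictMono.monotone hτ0.le
      rwa [Real.arctan_zero] at this
    have h1 : Real.sin (Real.arctan (tauV1 : ℝ)) ≤ Real.arctan (tauV1 : ℝ) := Real.sin_le hat0
    rw [Real.sin_arctan] at h1
    have hsq : Real.sqrt (1 + (tauV1 : ℝ) ^ 2) < (tauV1 : ℝ) / (3/20) := by
      rw [Real.sqrt_lt' (div_pos hτ0 (by norm_num))]
      have : (1 : ℚ) + tauV1 ^ 2 < (tauV1 / (3/20)) ^ 2 := by norm_num [tauV1]
      have h := (Rat.cast_lt (K := ℝ)).2 this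
      push_cast at h
      exact h
    have hpos : 0 < Real.sqrt (1 + (tauV1 : ℝ) ^ 2) := Real.sqrt_pos.2 (by positivity)
    have h2 : (3/20 : ℝ) < (tauV1 : ℝ) / Real.sqrt (1 + (tauV1 : ℝ) ^ 2) := by
      rw [lt_div_iff₀ hpos]
      have := mul_lt_mul_of_pos_left hsq (show (0 : ℝ) < 3/20 by norm_num)
      calc (3/20 : ℝ) * Real.sqrt (1 + (tauV1 : ℝ) ^ 2)
          < 3/20 * ((tauV1 : ℝ) / (3/20)) := this
        _ = (tauV1 : ℝ) := by field_simp
    exact h2.trans_le h1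
  have hθq : (3/10 : ℝ) < θ := by unfold θ; linarith
  have hden : 0 < π / 2 - θ := by linarith
  have hdenU : π / 2 - θ < 1.5707965 - 3/10 := by linarith [Real.pi_lt_d6]
  rw [sectorGain, abs_of_nonneg hθ0, lt_div_iff₀ hden, hsin]
  have hnum : (11/20 : ℝ) * (1.5707965 - 3/10)
      < 1 - 2 * (tauV1 : ℝ) / (1 + (tauV1 : ℝ) ^ 2) := by
    have : (11/20 : ℚ) * (1.5707965 - 3/10) < 1 - 2 * tauV1 / (1 + tauV1 ^ 2) := by
      norm_num [tauV1]
    have h := (Rat.cast_lt (K := ℝ)).2 this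
    push_cast at h
    exact h
  nlinarith

/-- **Every rational gain `g ≤ 11/20` is a strict sector gain on all 8 lines**: `g < g⋆(δ*_e)`.
[cite: VuTuritsyn2017, §4.2 Lemma 2] -/
theorem gain_lt {g : ℝ} (hg : g ≤ 11/20) (e : Fin 8) :
    g < sectorGain (δ₀ (srcV e) - δ₀ (tgtV e)) :=
  gain_lt_sectorGain_of_le (σs := fun e => δ₀ (srcV e) - δ₀ (tgtV e)) theta_bounds.1
    theta_bounds.2 lineAngle_abs_le_theta (hg.trans_lt sectorGain_theta_gt) e

/-! ## Rational level tests -/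

/-- A rational radius below every `π/2 − |δ*_e|`: `ρ = 1.570796 − 2τ_max` (≈ 1.2668). -/
def levelRadius : ℚ := 1.570796 - 2 * tauV1

/-- `ρ < π/2 − |δ*_e|` for every listed line (`|δ*_e| ≤ θ ≤ 2τ` since `arctan τ ≤ τ`; `π > 3.141592`). -/
theorem levelRadius_lt (e : Fin 8) :
    (levelRadius : ℝ) < π / 2 - |δ₀ (srcV e) - δ₀ (tgtV e)| := by
  have h1 := lineAngle_abs_le_theta e
  have h2 : θ ≤ 2 * (tauV1 : ℝ) := by
    have hτ0 : (0 : ℝ) ≤ (tauV1 : ℝ) := by exact_mod_cast (show (0 : ℚ) ≤ tauV1 by norm_num [tauV1])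
    unfold θ
    linarith [Lyapunov.StructurePreserving.arctan_le_self hτ0]
  have h3 := Real.pi_gt_d6
  have h4 : ((levelRadius : ℚ) : ℝ) = 1.570796 - 2 * (tauV1 : ℝ) := by
    push_cast [levelRadius]; ring
  rw [h4]
  linarith

/-- **Rational level test** (rank-one route): `s_e > 0` and `c·s_e ≤ ρ²` on all 8 lines give the level
hypothesis `c < (π/2 − |δ*_e|)²/s_e`. [cite: VuTuritsyn2017, §4.3 eq. (V_min)] -/
theorem level_of_rational {s : Fin 8 → ℝ} (hs0 : ∀ e, 0 < s e) {c : ℝ}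
    (hc : ∀ e, c * s e ≤ (levelRadius : ℝ) ^ 2) (e : Fin 8) :
    c < (π / 2 - |δ₀ (srcV e) - δ₀ (tgtV e)|) ^ 2 / s e := by
  rw [lt_div_iff₀ (hs0 e)]
  have hρ0 : (0 : ℝ) ≤ (levelRadius : ℝ) := by
    exact_mod_cast (show (0 : ℚ) ≤ levelRadius by norm_num [levelRadius, tauV1])
  have hlt := levelRadius_lt e
  have hsq : (levelRadius : ℝ) ^ 2 < (π / 2 - |δ₀ (srcV e) - δ₀ (tgtV e)|) ^ 2 :=
    pow_lt_pow_left₀ hlt hρ0 two_ne_zero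
  exact (hc e).trans_lt hsq

/-- **Rational `ε`-level test**: `2c ≤ ε·ρ²` puts `c` strictly below `ε·(π/2 − |δ*_e|)²/2` on every
listed line. [cite: VuTuritsyn2017, §4.3 eq. (V_min)] -/
theorem epsLevel_lt {D : Fin 9 → ℝ} (Λ : QuadraticCertificate (relLurie D)) {c : ℝ}
    (hc : 2 * c ≤ Λ.ε * (levelRadius : ℝ) ^ 2) (e : Fin 8) :
    2 * c < Λ.ε * (π / 2 - |δ₀ (srcV e) - δ₀ (tgtV e)|) ^ 2 := by
  have hρ0 : (0 : ℝ) ≤ (levelRadius : ℝ) := by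
    exact_mod_cast (show (0 : ℚ) ≤ levelRadius by norm_num [levelRadius, tauV1])
  have hsq : (levelRadius : ℝ) ^ 2 < (π / 2 - |δ₀ (srcV e) - δ₀ (tgtV e)|) ^ 2 :=
    pow_lt_pow_left₀ (levelRadius_lt e) hρ0 two_ne_zero
  have h := mul_lt_mul_of_pos_left hsq Λ.ε_pos
  linarith

/-- The `ε`-level passes the rational level test with the uniform constants `s_e := 2/ε`. -/
theorem epsLevel_rational {D : Fin 9 → ℝ} (Λ : QuadraticCertificate (relLurie D)) {c : ℝ}
    (hc : 2 * c ≤ Λ.ε * (levelRadius : ℝ) ^ 2) (_e : Fin 8) :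
    c * (2 / Λ.ε) ≤ (levelRadius : ℝ) ^ 2 := by
  have hε := Λ.ε_pos
  rw [mul_div_assoc', div_le_iff₀ hε]
  linarith

/-! ## The lane's sentence for the canary, modulo the certificate -/

/-- **SP–Lur'e sentence for «WSCC9-SP9», MODULO THE CERTIFICATE (rank-one route).** For every
DECLARED damping / load-frequency vector `D > 0` and every exact quadratic certificate `Λ = (P, g, ε)`
for `relLurie D` [cite: VuTuritsyn2017, §4.2 Lemma 1] with `g ≤ 11/20`, rank-one level facts
`s_e·P − C_eᵀC_e ⪰ 0`, `s_e > 0`, and a level `c < (π/2 − |δ*_e|)²/s_e` on all 8 lines: from every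
phase point `y = (δ, ω)` whose listed line angles lie in `(−π/2, π/2)` and with `V(relState y) ≤ c`,
(a) a solution of MODEL M′ = `(params D).phaseField` exists (unique by `phaseSolution_unique`), and
(b) EVERY solution from `y` keeps the 8 line angles in `(−π/2, π/2)` and `V ≤ c` for all `t ≥ 0`, every
bus-angle difference tends to the equilibrium's and every machine frequency deviation tends to `0`.
CERTIFIED given `Λ`; MODELLED: the `WSCC9SP` tokens + D⟨declared⟩ + ref bus 9; inner estimate; canary,
NOT of record. [cite: VuTuritsyn2017, §4.3 Theorem 1] -/
theorem lurie_roa {D : Fin 9 → ℝ} (hD : ∀ i, 0 < D i) (Λ : QuadraticCertificate (relLurie D))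
    (hg : Λ.g ≤ 11/20) {s : Fin 8 → ℝ} (hs0 : ∀ e, 0 < s e)
    (hs : ∀ e, (s e • Λ.P - Matrix.vecMulVec ((relLurie D).C e) ((relLurie D).C e)).PosSemidef)
    {c : ℝ} (hcs : ∀ e, c < (π / 2 - |δ₀ (srcV e) - δ₀ (tgtV e)|) ^ 2 / s e)
    {y : (Fin 9 → ℝ) × (Fin 9 → ℝ)} (hy : ∀ e, |y.1 (srcV e) - y.1 (tgtV e)| < π / 2)
    (hyc : Λ.V (relState ref gnode δ₀ y) ≤ c) :
    (∃ X : ℝ → (Fin 9 → ℝ) × (Fin 9 → ℝ), X 0 = y ∧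
        ∀ T : ℝ, ∀ t ∈ Icc 0 T, HasDerivWithinAt X ((params D).phaseField (X t)) (Icc 0 T) t) ∧
      ∀ X : ℝ → (Fin 9 → ℝ) × (Fin 9 → ℝ), X 0 = y →
        (∀ T : ℝ, ∀ t ∈ Icc 0 T, HasDerivWithinAt X ((params D).phaseField (X t)) (Icc 0 T) t) →
        (∀ t, 0 ≤ t → (∀ e, |(X t).1 (srcV e) - (X t).1 (tgtV e)| < π / 2) ∧
            Λ.V (relState ref gnode δ₀ (X t)) ≤ c) ∧
          (∀ v w, Tendsto (fun t => (X t).1 v - (X t).1 w) atTop (𝓝 (δ₀ v - δ₀ w))) ∧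
          ∀ v ∈ genS, Tendsto (fun t => (X t).2 v) atTop (𝓝 0) := by
  refine ⟨(params D).exists_phaseSolution_Icc y, fun X hX0 hX => ?_⟩
  subst hX0
  obtain ⟨hstay, hlim⟩ := tendsto_relState_of_quadraticCertificate_of_rankOne (wellFormed hD)
    ref_gnode.1 ref_gnode.2 mem_genS_iff (params_b_eq D) (preconnected D) (pe_δ₀_eq_P0 D) Λ
    lineAngle_abs_lt (gain_lt hg) hs0 hs hcs hX hy hyc
  exact ⟨hstay, tendsto_of_tendsto_relState (p := params D) mem_genS_iff hlim⟩

/-- **The same sentence from the RATIONAL level test** `c·s_e ≤ ρ²`.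
[cite: VuTuritsyn2017, §4.3 Theorem 1 with eq. (V_min)] -/
theorem lurie_roa_of_rationalLevel {D : Fin 9 → ℝ} (hD : ∀ i, 0 < D i)
    (Λ : QuadraticCertificate (relLurie D)) (hg : Λ.g ≤ 11/20) {s : Fin 8 → ℝ}
    (hs0 : ∀ e, 0 < s e)
    (hs : ∀ e, (s e • Λ.P - Matrix.vecMulVec ((relLurie D).C e) ((relLurie D).C e)).PosSemidef)
    {c : ℝ} (hc : ∀ e, c * s e ≤ (levelRadius : ℝ) ^ 2)
    {y : (Fin 9 → ℝ) × (Fin 9 → ℝ)} (hy : ∀ e, |y.1 (srcV e) - y.1 (tgtV e)| < π / 2)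
    (hyc : Λ.V (relState ref gnode δ₀ y) ≤ c) :
    (∃ X : ℝ → (Fin 9 → ℝ) × (Fin 9 → ℝ), X 0 = y ∧
        ∀ T : ℝ, ∀ t ∈ Icc 0 T, HasDerivWithinAt X ((params D).phaseField (X t)) (Icc 0 T) t) ∧
      ∀ X : ℝ → (Fin 9 → ℝ) × (Fin 9 → ℝ), X 0 = y →
        (∀ T : ℝ, ∀ t ∈ Icc 0 T, HasDerivWithinAt X ((params D).phaseField (X t)) (Icc 0 T) t) →
        (∀ t, 0 ≤ t → (∀ e, |(X t).1 (srcV e) - (X t).1 (tgtV e)| < π / 2) ∧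
            Λ.V (relState ref gnode δ₀ (X t)) ≤ c) ∧
          (∀ v w, Tendsto (fun t => (X t).1 v - (X t).1 w) atTop (𝓝 (δ₀ v - δ₀ w))) ∧
          ∀ v ∈ genS, Tendsto (fun t => (X t).2 v) atTop (𝓝 0) :=
  lurie_roa hD Λ hg hs0 hs (level_of_rational hs0 hc) hy hyc

/-- **The same sentence in the PRINTED second-order vocabulary** (`(params D).IsSolution δ`:
`Mᵥδ̈ᵥ + Dᵥδ̇ᵥ + fᵥ(δ) = P⁰ᵥ` at all 9 nodes; `ω₀ = 0`). MODELLED as `lurie_roa`.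
[cite: VuTuritsyn2017, §4.3 Theorem 1]; [cite: Padiyar2013, §3.2 eq (3.2)] -/
theorem lurie_roa_of_isSolution {D : Fin 9 → ℝ} (hD : ∀ i, 0 < D i)
    (Λ : QuadraticCertificate (relLurie D)) (hg : Λ.g ≤ 11/20) {s : Fin 8 → ℝ}
    (hs0 : ∀ e, 0 < s e)
    (hs : ∀ e, (s e • Λ.P - Matrix.vecMulVec ((relLurie D).C e) ((relLurie D).C e)).PosSemidef)
    {c : ℝ} (hc : ∀ e, c * s e ≤ (levelRadius : ℝ) ^ 2)
    {δ : ℝ → Fin 9 → ℝ} (hδ : (params D).IsSolution δ)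
    (h0 : ∀ e, |δ 0 (srcV e) - δ 0 (tgtV e)| < π / 2)
    (hVc : Λ.V (relState ref gnode δ₀ (δ 0, fun v => deriv (fun u => δ u v) 0)) ≤ c) :
    (∀ t, 0 ≤ t → ∀ e, |δ t (srcV e) - δ t (tgtV e)| < π / 2) ∧
      (∀ v w, Tendsto (fun t => δ t v - δ t w) atTop (𝓝 (δ₀ v - δ₀ w))) ∧
      ∀ v ∈ genS, Tendsto (fun t => deriv (fun u => δ u v) t) atTop (𝓝 0) := by
  have hsf : (params D).syncFreq = 0 := syncFreq_eq_zero D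
  have hVc' : Λ.V (relState ref gnode δ₀
      (δ 0, fun v => deriv (fun u => δ u v) 0 - (params D).syncFreq)) ≤ c := by
    simpa only [hsf, sub_zero] using hVc
  have h := tendsto_of_isSolution_of_quadraticCertificate (p := params D) (wellFormed hD)
    ref_gnode.1 ref_gnode.2 mem_genS_iff (params_b_eq D) (preconnected D) (isSyncEquilibrium D)
    Λ lineAngle_abs_lt (gain_lt hg)
    (fun _ hx => Λ.lt_V_of_mem_frontier_halfPolytope lineAngle_abs_lt hs0 hs
      (level_of_rational hs0 hc) hx) hδ h0 hVc'
  rw [hsf] at h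
  exact h

/-! ## The sentence with the `ε`-level: NO rank-one facts (filing route of record for the canary) -/

/-- **SP–Lur'e sentence for «WSCC9-SP9» with the `ε`-LEVEL — the producer supplies ONLY
`Λ = (P, g, ε)`** (its two 11 × 11 PosSemidef facts) and a rational `c` with `2c ≤ ε·ρ²`
(`ρ = 1.570796 − 2τ_max`): conclusions as `lurie_roa`. Kernel obligations left to a producer: the two
positive-semidefiniteness fields of `Λ` and two rational inequalities — no per-line fact
(`Params.relLurie_rankOne_of_eps`, p496574). CERTIFIED given `Λ`; MODELLED as `lurie_roa`; canary, NOT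
of record. [cite: VuTuritsyn2017, §4.3 Theorem 1 with eq. (V_min)] -/
theorem lurie_roa_of_eps {D : Fin 9 → ℝ} (hD : ∀ i, 0 < D i)
    (Λ : QuadraticCertificate (relLurie D)) (hg : Λ.g ≤ 11/20)
    {c : ℝ} (hc : 2 * c ≤ Λ.ε * (levelRadius : ℝ) ^ 2)
    {y : (Fin 9 → ℝ) × (Fin 9 → ℝ)} (hy : ∀ e, |y.1 (srcV e) - y.1 (tgtV e)| < π / 2)
    (hyc : Λ.V (relState ref gnode δ₀ y) ≤ c) :
    (∃ X : ℝ → (Fin 9 → ℝ) × (Fin 9 → ℝ), X 0 = y ∧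
        ∀ T : ℝ, ∀ t ∈ Icc 0 T, HasDerivWithinAt X ((params D).phaseField (X t)) (Icc 0 T) t) ∧
      ∀ X : ℝ → (Fin 9 → ℝ) × (Fin 9 → ℝ), X 0 = y →
        (∀ T : ℝ, ∀ t ∈ Icc 0 T, HasDerivWithinAt X ((params D).phaseField (X t)) (Icc 0 T) t) →
        (∀ t, 0 ≤ t → (∀ e, |(X t).1 (srcV e) - (X t).1 (tgtV e)| < π / 2) ∧
            Λ.V (relState ref gnode δ₀ (X t)) ≤ c) ∧
          (∀ v w, Tendsto (fun t => (X t).1 v - (X t).1 w) atTop (𝓝 (δ₀ v - δ₀ w))) ∧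
          ∀ v ∈ genS, Tendsto (fun t => (X t).2 v) atTop (𝓝 0) :=
  lurie_roa_of_rationalLevel hD Λ hg (s := fun _ => 2 / Λ.ε) (fun _ => div_pos two_pos Λ.ε_pos)
    (fun e => relLurie_rankOne_of_eps (params D) ref gnode srcV tgtV wt δ₀ Λ e)
    (epsLevel_rational Λ hc) hy hyc

/-- **The `ε`-level sentence in the PRINTED second-order vocabulary** (`(params D).IsSolution δ`).
MODELLED as `lurie_roa_of_eps`. [cite: VuTuritsyn2017, §4.3 Theorem 1]; [cite: Padiyar2013, §3.2 eq (3.2)] -/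
theorem lurie_roa_of_eps_of_isSolution {D : Fin 9 → ℝ} (hD : ∀ i, 0 < D i)
    (Λ : QuadraticCertificate (relLurie D)) (hg : Λ.g ≤ 11/20)
    {c : ℝ} (hc : 2 * c ≤ Λ.ε * (levelRadius : ℝ) ^ 2)
    {δ : ℝ → Fin 9 → ℝ} (hδ : (params D).IsSolution δ)
    (h0 : ∀ e, |δ 0 (srcV e) - δ 0 (tgtV e)| < π / 2)
    (hVc : Λ.V (relState ref gnode δ₀ (δ 0, fun v => deriv (fun u => δ u v) 0)) ≤ c) :
    (∀ t, 0 ≤ t → ∀ e, |δ t (srcV e) - δ t (tgtV e)| < π / 2) ∧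
      (∀ v w, Tendsto (fun t => δ t v - δ t w) atTop (𝓝 (δ₀ v - δ₀ w))) ∧
      ∀ v ∈ genS, Tendsto (fun t => deriv (fun u => δ u v) t) atTop (𝓝 0) := by
  have hsf : (params D).syncFreq = 0 := syncFreq_eq_zero D
  have hVc' : Λ.V (relState ref gnode δ₀
      (δ 0, fun v => deriv (fun u => δ u v) 0 - (params D).syncFreq)) ≤ c := by
    simpa only [hsf, sub_zero] using hVc
  have h := tendsto_of_isSolution_of_quadraticCertificate (p := params D) (wellFormed hD)
    ref_gnode.1 ref_gnode.2 mem_genS_iff (params_b_eq D) (preconnected D) (isSyncEquilibrium D)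
    Λ lineAngle_abs_lt (gain_lt hg)
    (relLurie_lt_V_frontier_of_eps Λ lineAngle_abs_lt (epsLevel_lt Λ hc)) hδ h0 hVc'
  rw [hsf] at h
  exact h

end Summit.Ventures.GridStability.Models.WSCC9SP

end
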